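/-
Origin: expansion seat `planner-pub-hodgecm-pv01-g4-0`, handover #4 v3 2026-08-18T06:49:24Z (`HOME/pub-hodgecm-pv01-g4/lean/Pv01g4/EndStateSeparation.lean`, md5 98ed4e1d, 478 lines);
landed by the gen-7 packager in gate run 25 as `HodgeCM/PerL34/EndStateSeparation.lean` (import ^import Pv[0-9]+g[0-9]+\.→import HodgeCM.PerL34. ×1).
-/
/-
Origin: planner-pub-hodgecm-pv01-g4-0 (unit pub-hodgecm-pv01-g4, DAG-NODE PROVER #01 gen 4), 2026-08-18.
Proposed tree path: `HodgeCM/PerL34/EndStateSeparation.lean` (new, additive; fresh namespace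
`HodgeCM.PerL34.EndStateSeparation` + one dot-declaration `HodgeCM.Universe.ThetaModel.pin`).  Imports this seat's
`Pv01g4.EndStateCensus` (↦ `HodgeCM.PerL34.EndStateCensus`) and the LANDED `HodgeCM.Proofs.LandherrDischarge` (r22),
`HodgeCM.Proofs.Prop22.Multilinear`.  KERNEL: nothing cited, nothing asserted — a separating model built with the
landed `ThetaModel.withTheta` (toy2, `Model/ThetaSeparation.lean`).
-/
import Summits.HodgeConjecture.HodgeCM.PerL34.EndStateCensus
import Summits.HodgeConjecture.HodgeCM.Proofs.LandherrDischarge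
import Summits.HodgeConjecture.HodgeCM.Proofs.Prop22.Multilinear

/-!
# The S1 binder of the headline is STRICTLY stronger than node N33 inside the end state

`EndStateStrength` proved `WeilStepsInputCRΔ T ↔ T.Open_thetaWedge ∧ ThetaMeet T` inside the end state.  Here:
`ThetaMeet` — hence the S1 binder `hW` of `AssemblyRoutes.perL_of_openCharsWeilLeavesCRΔ` — is NOT a consequence
of the headline's OTHER record binders (`hAlb`, `hbr`, `hQ`, `A12`, `A34`, `hch`) together with node N33's A6, nor
of the six node leaves `EndStateCensus.NodeLeaves`, over the same universe (re-choosing only the theta one-forms).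

Separating model `T.pin hw`: keep everything of `T` except the theta one-forms of types `Ψ₀, Ψ₁`, which are
replaced, in each good context, by the two SINGLETONS `{ω₁}`, `{ω₂}` at the level `Γ` of a chosen Prop-4.3
witness `(Γ, ω₁, ω₂)` of `T`, and by `∅` at every other level.  Skew-symmetry of the cup product on `H¹`
(`Fact_cup_comm1`, a component of `ModelAxioms`; `Universe.cup2C_self`) gives `ω₁ ≠ ω₂`, so the singletons are
disjoint.  Then (all KERNEL):

* `pin_nodeLeaves : NodeLeaves T → NodeLeaves (T.pin hw)` and `pin_dictLeavesSansMeet : DictLeaves T Pc →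
  DictLeavesSansMeet (T.pin hw) Pc` — typing, the seesaw-generator identity and `Λ ω₁ ω₂ ∈ S₁₂` (same pair),
  (34)-data and torus data unchanged, charts unchanged, the same Prop-4.3 witness;
* `pin_not_thetaMeet (hc1 hκ hs) : ¬ ThetaMeet (T.pin hw)` (a good context exists by the design constraints,
  `exists_goodCtx''`, Landherr's lemma being a theorem); `pin_not_weilStepsInputCRΔ`; `pin_not_hereditary`;
* `pin_recordsSansWeil (h : HeadlineBundle T Pc) : RecordsSansWeil (T.pin _) Pc` — the headline's six other
  record binders survive (S4/S5/S6 dictionaries are hypothesis-free in the leaves ⇒ records direction);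
* packaged: `exists_records_thetaWedge_not_weil` / `exists_nodeLeaves_not_weilStepsInputCRΔ`;
* `ZeroTheta` (the zero class is a theta form of types `Ψ₀, Ψ₁`; true in the intended model, `StepsVacuity` (ii))
  gives `ThetaMeet` (`thetaMeet_of_zeroTheta`), hence A6 + `ZeroTheta` ⇒ `hW` inside the end state; `T.pin` violates it.

So, with `EndStateStrength` / `EndStateVerdict`: inside the end state the headline's `hW` is EXACTLY `A6 ∧ ThetaMeet`,
and the surplus `ThetaMeet` over node N33 is independent of everything else in the headline (PerL itself needs none
of it: `AssemblyNoLandherr.perL_of_nodes''`, cf. `pin_perL`).  `Fact_coverTheta` (level-freeness) is NOT claimed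
for `T.pin hw`.
-/

set_option autoImplicit false

noncomputable section

namespace HodgeCM
namespace PerL34
namespace EndStateSeparation

open HodgeCM.Prior.Perl34File HodgeCM.Prior.Perl34File.Perl34 HodgeCM.PerL34.ArchC
open HodgeCM.PerL34.EndStateStrength HodgeCM.PerL34.EndStateCensus HodgeCM.PerL34.CharSpansFinal

variable {U : Universe} (T : U.ThetaModel)

/-! ## Transport along `Σ Γ, H¹(P_Γ)` equalities -/

section transport

variable {ι : Type*} {F : ι → Type*}

/-- (Ported verbatim from the HodgeCMPerL package; no docstring in the source.) -/
theorem transport₁ (P : ∀ i, F i → Prop) {i j : ι} {x : F i} {y : F j}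
    (e : (⟨i, x⟩ : Σ k, F k) = ⟨j, y⟩) (h : P j y) : P i x := by
  cases e; exact h

/-- (Ported verbatim from the HodgeCMPerL package; no docstring in the source.) -/
theorem transport₂ (P : ∀ i, F i → F i → Prop) {i j : ι} {x x' : F i} {y y' : F j}
    (e : (⟨i, x⟩ : Σ k, F k) = ⟨j, y⟩) (e' : (⟨i, x'⟩ : Σ k, F k) = ⟨j, y'⟩) (h : P j y y') : P i x x' := by
  cases e; cases e'; exact h

/-- (Ported verbatim from the HodgeCMPerL package; no docstring in the source.) -/
theorem eq_of_sigma_eq {i : ι} {x y : F i} (e : (⟨i, x⟩ : Σ k, F k) = ⟨i, y⟩) : x = y := by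
  cases e; rfl

end transport

/-! ## The chosen Prop-4.3 witness of `T` in a good context -/

section pick

variable {T}
variable (hw : T.Open_thetaWedge)
variable {L : CMField} {ι₁ : L →+* ℂ} (V : HermSpace3 L ι₁) (c : SeesawCtx L) (hc : T.GoodCtx ι₁ c)

/-- The level of the chosen witness. -/
def pickΓ : Level V := Classical.choose (hw V c hc)

/-- The chosen type-`Ψ₀` form. -/
def pickω₁ : U.CohC (U.pms L ι₁ V (pickΓ hw V c hc)) 1 :=
  Classical.choose (Classical.choose_spec (hw V c hc))

/-- (Ported verbatim from the HodgeCMPerL package; no docstring in the source.) -/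
theorem pickω₁_mem : pickω₁ hw V c hc ∈ T.Theta V c 0 (pickΓ hw V c hc) :=
  (Classical.choose_spec (Classical.choose_spec (hw V c hc))).1

/-- The chosen type-`Ψ₁` form. -/
def pickω₂ : U.CohC (U.pms L ι₁ V (pickΓ hw V c hc)) 1 :=
  Classical.choose (Classical.choose_spec (Classical.choose_spec (hw V c hc))).2

/-- (Ported verbatim from the HodgeCMPerL package; no docstring in the source.) -/
theorem pickω₂_mem : pickω₂ hw V c hc ∈ T.Theta V c 1 (pickΓ hw V c hc) :=
  (Classical.choose_spec (Classical.choose_spec (Classical.choose_spec (hw V c hc))).2).1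

/-- (Ported verbatim from the HodgeCMPerL package; no docstring in the source.) -/
theorem pick_cup_ne_zero :
    U.cup2C (U.pms L ι₁ V (pickΓ hw V c hc)) 1 (pickω₁ hw V c hc) (pickω₂ hw V c hc) ≠ 0 :=
  (Classical.choose_spec (Classical.choose_spec (Classical.choose_spec (hw V c hc))).2).2

/-- The two chosen forms differ: `ω ∪ ω = 0` on `H¹` (`Fact_cup_comm1`). -/
theorem pickω₂_ne_pickω₁ (hc1 : U.Fact_cup_comm1) : pickω₂ hw V c hc ≠ pickω₁ hw V c hc := by
  intro e
  exact pick_cup_ne_zero hw V c hc (by rw [e, Universe.cup2C_self hc1])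

end pick

/-! ## The pinned theta model -/

/-- The re-chosen theta one-forms: the singletons `{ω₁}`, `{ω₂}` at the chosen level in a good context for the
types `Ψ₀`, `Ψ₁` (empty elsewhere / in bad contexts), `T`'s forms for the types `Ψ₂`, `Ψ₃`. -/
def pinTheta (hw : T.Open_thetaWedge) {L : CMField} {ι₁ : L →+* ℂ} (V : HermSpace3 L ι₁) (c : SeesawCtx L)
    (i : Fin 4) (Γ : Level V) : Set (U.CohC (U.pms L ι₁ V Γ) 1) :=
  if i = 0 then {ω | ∃ hc : T.GoodCtx ι₁ c,
      (⟨Γ, ω⟩ : Σ Γ' : Level V, U.CohC (U.pms L ι₁ V Γ') 1) = ⟨pickΓ hw V c hc, pickω₁ hw V c hc⟩}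
  else if i = 1 then {ω | ∃ hc : T.GoodCtx ι₁ c,
      (⟨Γ, ω⟩ : Σ Γ' : Level V, U.CohC (U.pms L ι₁ V Γ') 1) = ⟨pickΓ hw V c hc, pickω₂ hw V c hc⟩}
  else T.Theta V c i Γ

/-- **The separating model**: `T` with the theta one-forms of types `Ψ₀, Ψ₁` pinned to two singletons. -/
def _root_.HodgeCM.Universe.ThetaModel.pin (hw : T.Open_thetaWedge) : U.ThetaModel :=
  T.withTheta (pinTheta T hw)

variable (hw : T.Open_thetaWedge)

/-- (Ported verbatim from the HodgeCMPerL package; no docstring in the source.) -/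
theorem pin_eq_withTheta : T.pin hw = T.withTheta (pinTheta T hw) := rfl

/-- (Ported verbatim from the HodgeCMPerL package; no docstring in the source.) -/
theorem pin_Theta {L : CMField} {ι₁ : L →+* ℂ} (V : HermSpace3 L ι₁) (c : SeesawCtx L) (i : Fin 4)
    (Γ : Level V) : (T.pin hw).Theta V c i Γ = pinTheta T hw V c i Γ := rfl

/-- (Ported verbatim from the HodgeCMPerL package; no docstring in the source.) -/
theorem pinTheta_zero {L : CMField} {ι₁ : L →+* ℂ} (V : HermSpace3 L ι₁) (c : SeesawCtx L) (Γ : Level V) :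
    pinTheta T hw V c 0 Γ = {ω | ∃ hc : T.GoodCtx ι₁ c,
      (⟨Γ, ω⟩ : Σ Γ' : Level V, U.CohC (U.pms L ι₁ V Γ') 1) = ⟨pickΓ hw V c hc, pickω₁ hw V c hc⟩} := by
  simp [pinTheta]

/-- (Ported verbatim from the HodgeCMPerL package; no docstring in the source.) -/
theorem pinTheta_one {L : CMField} {ι₁ : L →+* ℂ} (V : HermSpace3 L ι₁) (c : SeesawCtx L) (Γ : Level V) :
    pinTheta T hw V c 1 Γ = {ω | ∃ hc : T.GoodCtx ι₁ c,
      (⟨Γ, ω⟩ : Σ Γ' : Level V, U.CohC (U.pms L ι₁ V Γ') 1) = ⟨pickΓ hw V c hc, pickω₂ hw V c hc⟩} := by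
  simp [pinTheta]

/-- (Ported verbatim from the HodgeCMPerL package; no docstring in the source.) -/
theorem pinTheta_two {L : CMField} {ι₁ : L →+* ℂ} (V : HermSpace3 L ι₁) (c : SeesawCtx L) (Γ : Level V) :
    pinTheta T hw V c 2 Γ = T.Theta V c 2 Γ := by
  simp [pinTheta]

/-- (Ported verbatim from the HodgeCMPerL package; no docstring in the source.) -/
theorem pinTheta_three {L : CMField} {ι₁ : L →+* ℂ} (V : HermSpace3 L ι₁) (c : SeesawCtx L) (Γ : Level V) :
    pinTheta T hw V c 3 Γ = T.Theta V c 3 Γ := by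
  simp [pinTheta]

/-- The (34) wedge set is unchanged. -/
theorem pin_wedgeSet23 {L : CMField} {ι₁ : L →+* ℂ} (V : HermSpace3 L ι₁) (c : SeesawCtx L) :
    (T.pin hw).wedgeSet V c 2 3 = T.wedgeSet V c 2 3 := by
  ext x
  simp only [Universe.ThetaModel.wedgeSet, Set.mem_setOf_eq, pin_Theta, pinTheta_two, pinTheta_three]
  rfl

/-! ## The pinned model keeps the record / dictionary / node leaves other than `ThetaMeet` -/

/-- (Ported verbatim from the HodgeCMPerL package; no docstring in the source.) -/
theorem pin_embCover_iff : (T.pin hw).Fact_embCover ↔ T.Fact_embCover := Iff.rfl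
/-- (Ported verbatim from the HodgeCMPerL package; no docstring in the source.) -/
theorem pin_innerEmb_iff : (T.pin hw).Fact_innerEmb ↔ T.Fact_innerEmb := Iff.rfl
/-- (Ported verbatim from the HodgeCMPerL package; no docstring in the source.) -/
theorem pin_kappaConj_iff : (T.pin hw).Design_kappaConj ↔ T.Design_kappaConj := Iff.rfl
/-- (Ported verbatim from the HodgeCMPerL package; no docstring in the source.) -/
theorem pin_frameSignConj_iff : (T.pin hw).Design_frameSignConj ↔ T.Design_frameSignConj := Iff.rfl
/-- (Ported verbatim from the HodgeCMPerL package; no docstring in the source.) -/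
theorem pin_goodCtx_iff {L : CMField} (ι₁ : L →+* ℂ) (c : SeesawCtx L) :
    (T.pin hw).GoodCtx ι₁ c ↔ T.GoodCtx ι₁ c := T.withTheta_goodCtx_iff _ ι₁ c
/-- (Ported verbatim from the HodgeCMPerL package; no docstring in the source.) -/
theorem pin_chars_iff : (T.pin hw).Open_chars ↔ T.Open_chars := T.withTheta_chars_iff _
/-- (Ported verbatim from the HodgeCMPerL package; no docstring in the source.) -/
theorem pin_occ_iff : (T.pin hw).Open_occ ↔ T.Open_occ := T.withTheta_occ_iff _

/-- (Ported verbatim from the HodgeCMPerL package; no docstring in the source.) -/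
theorem pin_thetaSub (hsub : T.Open_thetaSub) : (T.pin hw).Open_thetaSub := by
  refine (T.withTheta_thetaSub_iff _).mpr fun V c hc i Γ ω hω => ?_
  fin_cases i
  · obtain ⟨hc', e⟩ := (pinTheta_zero T hw V c Γ) ▸ hω
    exact transport₁ (fun Γ' (ω' : U.CohC (U.pms _ _ V Γ') 1) => ω' ∈ U.Uiso Γ' c.K (c.Ψ 0) c.σ) e
      (hsub V c hc 0 _ (pickω₁_mem hw V c hc'))
  · obtain ⟨hc', e⟩ := (pinTheta_one T hw V c Γ) ▸ hω
    exact transport₁ (fun Γ' (ω' : U.CohC (U.pms _ _ V Γ') 1) => ω' ∈ U.Uiso Γ' c.K (c.Ψ 1) c.σ) e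
      (hsub V c hc 1 _ (pickω₂_mem hw V c hc'))
  · exact hsub V c hc 2 Γ ((pinTheta_two T hw V c Γ) ▸ hω)
  · exact hsub V c hc 3 Γ ((pinTheta_three T hw V c Γ) ▸ hω)

/-- (Ported verbatim from the HodgeCMPerL package; no docstring in the source.) -/
theorem pin_thetaGen12 (hgen : T.Open_thetaGen12) : (T.pin hw).Open_thetaGen12 := by
  refine (T.withTheta_thetaGen12_iff _).mpr fun V c hc Γ ω₁ ω₂ h₁ h₂ => ?_
  obtain ⟨hc₁, e₁⟩ := (pinTheta_zero T hw V c Γ) ▸ h₁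
  obtain ⟨hc₂, e₂⟩ := (pinTheta_one T hw V c Γ) ▸ h₂
  exact transport₂ (fun Γ' (x y : U.CohC (U.pms _ _ V Γ') 1) => T.Λ Γ' x y ∈ (T.t12 V c).S12) e₁ e₂
    (hgen V c hc _ _ _ (pickω₁_mem hw V c hc₁) (pickω₂_mem hw V c hc₁))

/-- The seesaw-generator identity (dictionary leaf of `hbr`) survives: same pair, same `Λ`. -/
theorem pin_genIdentity
    (hgen : ∀ {L : CMField} {ι₁ : L →+* ℂ} (V : HermSpace3 L ι₁) (c : SeesawCtx L), T.GoodCtx ι₁ c →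
      N19w_genIdentity T V c (T.t12 V c) 0 1) :
    ∀ {L : CMField} {ι₁ : L →+* ℂ} (V : HermSpace3 L ι₁) (c : SeesawCtx L), (T.pin hw).GoodCtx ι₁ c →
      N19w_genIdentity (T.pin hw) V c ((T.pin hw).t12 V c) 0 1 := by
  intro L ι₁ V c hc Γ ω hω ω' hω'
  have hcT : T.GoodCtx ι₁ c := (pin_goodCtx_iff T hw ι₁ c).mp hc
  obtain ⟨hc₁, e₁⟩ := (pinTheta_zero T hw V c Γ) ▸ (show ω ∈ pinTheta T hw V c 0 Γ from hω)
  obtain ⟨hc₂, e₂⟩ := (pinTheta_one T hw V c Γ) ▸ (show ω' ∈ pinTheta T hw V c 1 Γ from hω')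
  show ∃ χ : (T.t12 V c).X, ∃ Φ : T.SK V c, T.Λ Γ ω ω' = (T.t12 V c).ϑ χ Φ
  exact transport₂ (fun Γ' (x y : U.CohC (U.pms _ _ V Γ') 1) =>
      ∃ χ : (T.t12 V c).X, ∃ Φ : T.SK V c, T.Λ Γ' x y = (T.t12 V c).ϑ χ Φ) e₁ e₂
    (hgen V c hcT _ _ (pickω₁_mem hw V c hc₁) _ (pickω₂_mem hw V c hc₁))

/-- (Ported verbatim from the HodgeCMPerL package; no docstring in the source.) -/
theorem pin_thetaReal34 (hre : T.Open_thetaReal34) : (T.pin hw).Open_thetaReal34 := by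
  refine (T.withTheta_thetaReal34_iff _).mpr fun V c hc χ hχ Φ => ?_
  refine (Submodule.topologicalClosure_mono (Submodule.span_mono ?_)) (hre V c hc χ hχ Φ)
  rintro x ⟨Γ, ω, hω, ω', hω', rfl⟩
  exact ⟨Γ, ω, (pinTheta_two T hw V c Γ).symm ▸ hω, ω', (pinTheta_three T hw V c Γ).symm ▸ hω', rfl⟩

/-- The finite-sum core on the (34) side (dictionary leaf of `hQ`) survives: the (34) data are untouched. -/
theorem pin_core34
    (h : ∀ {L : CMField} {ι₁ : L →+* ℂ} (V : HermSpace3 L ι₁) (c : SeesawCtx L), T.GoodCtx ι₁ c →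
      N19g_core T V c (T.t34 V c) 2 3) :
    ∀ {L : CMField} {ι₁ : L →+* ℂ} (V : HermSpace3 L ι₁) (c : SeesawCtx L), (T.pin hw).GoodCtx ι₁ c →
      N19g_core (T.pin hw) V c ((T.pin hw).t34 V c) 2 3 := by
  intro L ι₁ V c hc
  obtain ⟨P, hP, hspan⟩ := h V c ((pin_goodCtx_iff T hw ι₁ c).mp hc)
  refine ⟨P, hP, fun χ hχ Φ hΦ => ?_⟩
  rw [pin_wedgeSet23]
  exact hspan χ hχ Φ hΦ

/-- (Ported verbatim from the HodgeCMPerL package; no docstring in the source.) -/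
theorem pin_thetaWedge : (T.pin hw).Open_thetaWedge := by
  refine (T.withTheta_thetaWedge_iff _).mpr fun V c hc => ?_
  refine ⟨pickΓ hw V c hc, pickω₁ hw V c hc, ?_, pickω₂ hw V c hc, ?_, pick_cup_ne_zero hw V c hc⟩
  · rw [pinTheta_zero]; exact ⟨hc, rfl⟩
  · rw [pinTheta_one]; exact ⟨hc, rfl⟩

/-- **The pinned model keeps all six node leaves.** -/
theorem pin_nodeLeaves (h : NodeLeaves T) : NodeLeaves (T.pin h.wedge) where
  thetaSub := pin_thetaSub T h.wedge h.thetaSub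
  gen12 := pin_thetaGen12 T h.wedge h.gen12
  real34 := pin_thetaReal34 T h.wedge h.real34
  occ := (pin_occ_iff T h.wedge).mpr h.occ
  chars := (pin_chars_iff T h.wedge).mpr h.chars
  wedge := pin_thetaWedge T h.wedge

/-- The dictionary leaves WITHOUT `ThetaMeet` (cf. `EndStateCensus.DictLeaves`). -/
structure DictLeavesSansMeet
    (Pc : ∀ {L : CMField} {ι₁ : L →+* ℂ} (V : HermSpace3 L ι₁) (c : SeesawCtx L),
      C4a.PointedCore (T.core V c)) : Prop where
  thetaSub : T.Open_thetaSub
  genIdentity : ∀ {L : CMField} {ι₁ : L →+* ℂ} (V : HermSpace3 L ι₁) (c : SeesawCtx L), T.GoodCtx ι₁ c →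
    N19w_genIdentity T V c (T.t12 V c) 0 1
  core34 : ∀ {L : CMField} {ι₁ : L →+* ℂ} (V : HermSpace3 L ι₁) (c : SeesawCtx L), T.GoodCtx ι₁ c →
    N19g_core T V c (T.t34 V c) 2 3
  charts12 : ∀ {L : CMField} {ι₁ : L →+* ℂ} (V : HermSpace3 L ι₁) (c : SeesawCtx L), T.GoodCtx ι₁ c →
    ∃ K : ArchCCore (T.core V c) (Pc V c), ∀ i, K.Eigen i → (T.t12 V c).wOccurs i
  charts34 : ∀ {L : CMField} {ι₁ : L →+* ℂ} (V : HermSpace3 L ι₁) (c : SeesawCtx L), T.GoodCtx ι₁ c →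
    ∃ K : ArchCCore (T.core V c) (Pc V c), ∀ i, K.Eigen i → (T.t34 V c).wOccurs i
  chars : T.Open_chars
  wedge : T.Open_thetaWedge

/-- (Ported verbatim from the HodgeCMPerL package; no docstring in the source.) -/
theorem dictLeavesSansMeet_of_dictLeaves
    (Pc : ∀ {L : CMField} {ι₁ : L →+* ℂ} (V : HermSpace3 L ι₁) (c : SeesawCtx L),
      C4a.PointedCore (T.core V c))
    (h : DictLeaves T Pc) : DictLeavesSansMeet T Pc :=
  ⟨h.thetaSub, h.genIdentity, h.core34, h.charts12, h.charts34, h.chars, h.wedge⟩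

/-- (Ported verbatim from the HodgeCMPerL package; no docstring in the source.) -/
theorem dictLeaves_iff_sansMeet_and_meet
    (Pc : ∀ {L : CMField} {ι₁ : L →+* ℂ} (V : HermSpace3 L ι₁) (c : SeesawCtx L),
      C4a.PointedCore (T.core V c)) :
    DictLeaves T Pc ↔ DictLeavesSansMeet T Pc ∧ ThetaMeet T :=
  ⟨fun h => ⟨dictLeavesSansMeet_of_dictLeaves T Pc h, h.meet⟩,
    fun ⟨h, hm⟩ => ⟨h.thetaSub, h.genIdentity, h.core34, h.charts12, h.charts34, h.chars, h.wedge, hm⟩⟩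

/-- **The pinned model keeps every dictionary leaf other than `ThetaMeet`** (`Pc` is literally the same datum:
`(T.pin hw).core = T.core`). -/
theorem pin_dictLeavesSansMeet
    (Pc : ∀ {L : CMField} {ι₁ : L →+* ℂ} (V : HermSpace3 L ι₁) (c : SeesawCtx L),
      C4a.PointedCore (T.core V c))
    (h : DictLeavesSansMeet T Pc) : DictLeavesSansMeet (T.pin h.wedge) Pc where
  thetaSub := pin_thetaSub T h.wedge h.thetaSub
  genIdentity := pin_genIdentity T h.wedge h.genIdentity
  core34 := pin_core34 T h.wedge h.core34
  charts12 := fun V c hc => h.charts12 V c ((pin_goodCtx_iff T h.wedge _ c).mp hc)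
  charts34 := fun V c hc => h.charts34 V c ((pin_goodCtx_iff T h.wedge _ c).mp hc)
  chars := (pin_chars_iff T h.wedge).mpr h.chars
  wedge := pin_thetaWedge T h.wedge

/-- The headline's record binders WITHOUT `hW` (cf. `EndStateCensus.HeadlineBundle`). -/
structure RecordsSansWeil
    (Pc : ∀ {L : CMField} {ι₁ : L →+* ℂ} (V : HermSpace3 L ι₁) (c : SeesawCtx L),
      C4a.PointedCore (T.core V c)) : Prop where
  alb : T.Fact_thetaAlbanese
  bridges : ∀ {L : CMField} {ι₁ : L →+* ℂ} (V : HermSpace3 L ι₁) (c : SeesawCtx L), T.GoodCtx ι₁ c →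
    Nonempty (SeesawDictionary.SeesawBridge T V c (T.t12 V c) 0 1)
  qaut : ∀ {L : CMField} {ι₁ : L →+* ℂ} (V : HermSpace3 L ι₁) (c : SeesawCtx L), T.GoodCtx ι₁ c →
    Nonempty (QautDictionary.QautBridge T V c (T.t34 V c) 2 3)
  arch12 : ∀ {L : CMField} {ι₁ : L →+* ℂ} (V : HermSpace3 L ι₁) (c : SeesawCtx L), T.GoodCtx ι₁ c →
    Nonempty (ArchCDatum (T.core V c) (T.t12 V c) (Pc V c))
  arch34 : ∀ {L : CMField} {ι₁ : L →+* ℂ} (V : HermSpace3 L ι₁) (c : SeesawCtx L), T.GoodCtx ι₁ c →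
    Nonempty (ArchCDatum (T.core V c) (T.t34 V c) (Pc V c))
  chars : T.Open_chars

/-- (Ported verbatim from the HodgeCMPerL package; no docstring in the source.) -/
theorem recordsSansWeil_of_headlineBundle
    (Pc : ∀ {L : CMField} {ι₁ : L →+* ℂ} (V : HermSpace3 L ι₁) (c : SeesawCtx L),
      C4a.PointedCore (T.core V c))
    (h : HeadlineBundle T Pc) : RecordsSansWeil T Pc :=
  ⟨h.alb, h.bridges, h.qaut, h.arch12, h.arch34, h.chars⟩

/-- (Ported verbatim from the HodgeCMPerL package; no docstring in the source.) -/
theorem headlineBundle_iff_records_and_weil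
    (Pc : ∀ {L : CMField} {ι₁ : L →+* ℂ} (V : HermSpace3 L ι₁) (c : SeesawCtx L),
      C4a.PointedCore (T.core V c)) :
    HeadlineBundle T Pc ↔ RecordsSansWeil T Pc ∧ WeilStepsInputCRΔ T :=
  ⟨fun h => ⟨recordsSansWeil_of_headlineBundle T Pc h, h.weil⟩,
    fun ⟨h, hW⟩ => ⟨h.alb, h.bridges, h.qaut, h.arch12, h.arch34, h.chars, hW⟩⟩

/-- Records without `hW` from dictionary leaves without `ThetaMeet` (S4/S5/S6 dictionaries, hypothesis-free). -/
theorem recordsSansWeil_of_dictLeavesSansMeet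
    (Pc : ∀ {L : CMField} {ι₁ : L →+* ℂ} (V : HermSpace3 L ι₁) (c : SeesawCtx L),
      C4a.PointedCore (T.core V c))
    (h : DictLeavesSansMeet T Pc) : RecordsSansWeil T Pc where
  alb := T.thetaAlbanese_of_open h.thetaSub
  bridges := fun V c hc => (S5Conservative.bridges_iff_genIdentity T).2 h.genIdentity V c hc
  qaut := fun V c hc => (S5ConservativeQaut.qautBridges_iff_core T).2 h.core34 V c hc
  arch12 := fun V c hc => (T.archC_binder_iff_core Pc (fun V c => T.t12 V c)).2 h.charts12 V c hc
  arch34 := fun V c hc => (T.archC_binder_iff_core Pc (fun V c => T.t34 V c)).2 h.charts34 V c hc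
  chars := h.chars

/-- … and conversely, given `M` and M38 (S6 needs `Fact_cmInflation`; A6 is then supplied separately). -/
theorem dictLeavesSansMeet_of_recordsSansWeil (M : U.ModelAxioms) (hM38 : U.Fact_cmInflation)
    (Pc : ∀ {L : CMField} {ι₁ : L →+* ℂ} (V : HermSpace3 L ι₁) (c : SeesawCtx L),
      C4a.PointedCore (T.core V c))
    (h : RecordsSansWeil T Pc) (hw : T.Open_thetaWedge) : DictLeavesSansMeet T Pc where
  thetaSub := T.open_thetaSub_of_split M hM38 h.alb
  genIdentity := fun V c hc => (S5Conservative.bridges_iff_genIdentity T).1 h.bridges V c hc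
  core34 := fun V c hc => (S5ConservativeQaut.qautBridges_iff_core T).1 h.qaut V c hc
  charts12 := fun V c hc => (T.archC_binder_iff_core Pc (fun V c => T.t12 V c)).1 h.arch12 V c hc
  charts34 := fun V c hc => (T.archC_binder_iff_core Pc (fun V c => T.t34 V c)).1 h.arch34 V c hc
  chars := h.chars
  wedge := hw

/-- **The pinned model keeps the headline's six record binders other than `hW`** (given `M`, M38 to read the
records of `T` as leaves). -/
theorem pin_recordsSansWeil (M : U.ModelAxioms) (hM38 : U.Fact_cmInflation)
    (Pc : ∀ {L : CMField} {ι₁ : L →+* ℂ} (V : HermSpace3 L ι₁) (c : SeesawCtx L),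
      C4a.PointedCore (T.core V c))
    (h : RecordsSansWeil T Pc) (hw : T.Open_thetaWedge) : RecordsSansWeil (T.pin hw) Pc :=
  recordsSansWeil_of_dictLeavesSansMeet (T.pin hw) Pc
    (pin_dictLeavesSansMeet T Pc (dictLeavesSansMeet_of_recordsSansWeil T M hM38 Pc h hw))

/-! ## … and refutes `ThetaMeet`, hence the S1 binder -/

/-- The two pinned singletons never meet (`Fact_cup_comm1`). -/
theorem pin_meet_empty (hc1 : U.Fact_cup_comm1) {L : CMField} {ι₁ : L →+* ℂ} (V : HermSpace3 L ι₁)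
    (c : SeesawCtx L) (Γ : Level V) :
    (T.pin hw).Theta V c 0 Γ ∩ (T.pin hw).Theta V c 1 Γ = ∅ := by
  ext ω
  simp only [Set.mem_inter_iff, Set.mem_empty_iff_false, iff_false, not_and]
  intro h₀ h₁
  obtain ⟨hc₀, e₀⟩ := (pinTheta_zero T hw V c Γ) ▸ (show ω ∈ pinTheta T hw V c 0 Γ from h₀)
  obtain ⟨hc₁, e₁⟩ := (pinTheta_one T hw V c Γ) ▸ (show ω ∈ pinTheta T hw V c 1 Γ from h₁)
  exact pickω₂_ne_pickω₁ hw V c hc₀ hc1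
    (eq_of_sigma_eq (F := fun Γ' : Level V => U.CohC (U.pms L ι₁ V Γ') 1) (e₁.symm.trans e₀))


-- port_pkg: scope closed for this part
end EndStateSeparation
end PerL34
end HodgeCM
end
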